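import Literature.NumberTheory.EllipticCurves.Kobayashi2003.SignedPAdicLFunctionUniqueProofs
import Literature.NumberTheory.EllipticCurves.Kobayashi2003.SignedPAdicLFunctionConstantTermProofs
import Literature.NumberTheory.EllipticCurves.CyclotomicInterpolantUniquenessProofs
import Literature.NumberTheory.EllipticCurves.PAdicPowerSeriesInterpolationAgreementProofs
import HarnessLib

/-!
# Burungale–Skinner–Tian–Wan, Thm. 3.16: the signed cyclotomic `p`-adic `L`-functions `𝓛^∘_{ω,γ}(g)`
# at a supersingular prime, in the tree's currency, and their dictionary with Pollack's / Kobayashi's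
# `L_p^±` (sign labelling and period normalisation)

Topic `Literature/NumberTheory/EllipticCurves`, cluster `BurungaleSkinnerTianWan2024` (A. Burungale,
C. Skinner, Y. Tian, X. Wan, *Zeta elements for elliptic curves and applications*, arXiv:2409.01350v2,
PREPRINT — store text `paper:arxiv-2409.01350`, TeX-numbered per Part; printed numbers below are those of
the arXiv v2 PDF, from the concordance `pub/bsd-litref/bstw24/sheets/LABELS-bstw24-v2.tsv`: the store's
"Theorem 2.16 / Lemma 1.5 / Remark 1.3 / Thm 2.17 / §2.4.1 / §5.1.1" are the printed Thm. 3.16 (label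
`pcycQss`), Lemma 2.5 (`GorPer`), Remark 2.3 (`EC-optperiod-rmk`), Thm. 3.17 (`ERLBKI-ss`), §3.4.1
(`characters-cyc`), §6.1.1). Work item `wi-79749` (route `SignedBaseChange` of the BSD summit, typing
brief `pub/bsd-wall/bsd-wall-ss/TYPING-BRIEF-2VAR-SIGNED-v1.md` §2 F4 = step D3c of K2R‴, item
stmt-BirchSwinnertonDyer-20213): "dictionary BSTW `𝓛^∘_{ω,γ}(g)` (Thm 2.16) ↔ Pollack's `L^±_p(E)` =
the tree's `IsPollackPair` / `kobayashiL`: sign labels and period ratio".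

HONEST FRAMING. BSTW is an unrefereed preprint: its Thm. 3.16 enters ONLY as a DEFINITION (the
interpolation frame `IsSignedCycLFunction`, claim-tagged) — nothing of BSTW is asserted. Everything else
in this file is PROVED from the tree's PUBLISHED inputs (Pollack 2003 via the named fact
`pollack_exists_plusMinusPAdicLFunction` where existence is needed; Kobayashi 2003's labelling
`Kobayashi2003.IsSignedPAdicLFunction`; Mazur–Tate–Teitelbaum 1986 §I.12–14 for `Λ ⊗ ℚ_p`). ZERO new
named facts (D-0026); one frame predicate and two bookkeeping definitions (the printed constants).

## The printed statement (store `p0025.txt` L37–75; conventions `p0024.txt` L71–89)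

"Supersingular case. Suppose `g` is supersingular. In this case, there are two signed `p`-adic
`L`-functions [Po]. **Theorem 3.16.** Suppose `a_p(g) = 0`. Let `∘ = ±`. There exists an unique
`𝓛^∘_{ω,γ}(g) ∈ ℚ_p ⊗_{ℤ_p} Λ_{𝒪_λ}` such that
`φ_ζ(𝓛^∘_{ω,γ}(g)) = e^∘_p(ζ) · L(1, g ⊗ ψ_ζ^{-1}) / Ω^+_{ω,γ}` for
`e^+_p(ζ) = (-1)^{(t+2)/2} · p^{t+1}/𝔤(ψ_ζ^{-1}) · ∏_{odd m=1}^{t-1} Φ_{p^m}(ζ)^{-1}` if `t > 0` even,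
`2` if `t = 0`; and `e^-_p(ζ) = (-1)^{(t+1)/2} · p^{t+1}/𝔤(ψ_ζ^{-1}) · ∏_{even m=2}^{t-1} Φ_{p^m}(ζ)^{-1}`
if `t > 0` odd, `p - 1` if `t = 0`. Here `Φ_{p^n}(X)` is the `p^n`th cyclotomic polynomial." with
(§3.4.1) "For `ζ` a primitive `p^t`-th root of unity, let `ψ_ζ : G_ℚ ↠ Γ → ℚ̄^×` be the finite order
character induced by `γ_cyc ↦ ζ`. For `t > 0`, let `ψ_ζ` also denote the Dirichlet character of
`(ℤ/p^{t+1}ℤ)^×` of `p`-power order such that the image of `ε(γ_cyc) ∈ 1 + pℤ_p` maps to `ζ`. Let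
`φ_ζ : Λ → ℤ_p[ζ]` be the homomorphism such that `γ_cyc ↦ ζ`", the periods (§2.2.7 "Periods")
`per(ω) = Ω^+_{ω,γ} · γ^+ + Ω^-_{ω,γ} · γ^-` for `0 ≠ ω ∈ S_F`, `γ ∈ V_F` with `γ^± ≠ 0`, `𝔤` "the usual
Gauss sum", and the SIGN LABELLING (footnote to §6.1.1): "While our labelling of signs is opposite to
[Po], it is consistent with the formulation of main conjectures in [Ko]". (The work item's informal text
has this footnote reversed; the print is as quoted: BSTW's `∘` = KOBAYASHI's `ε`, opposite to POLLACK.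
Check: `e^+_p(1) = 2`, `e^-_p(1) = p - 1` are Kobayashi's (3.6) `L_p^+(E,0) = 2 L(E,1)/Ω_E`,
`L_p^-(E,0) = (p-1) L(E,1)/Ω_E`, i.e. the tree's `L⁻(0) = 2[0]⁺`, `L⁺(0) = (p-1)[0]⁺` of Pollack's pair.)

## The tree's currency, and how the frame transcribes the print (for `g = f` a RATIONAL newform)

* `Λ_{𝒪_λ} = Λ = ℤ_p⟦T⟧ = IwasawaAlgebra p`, `ℚ_p ⊗_{ℤ_p} Λ = Λ[1/p] ⊆ ℚ_p⟦T⟧` (`MemIwasawaRat`),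
  `T = γ_cyc - 1` with the generator normalised by `ε(γ_cyc) = cyclotomicGenerator p = 1 + p`
  (odd `p`), so `φ_ζ(F) = F(ζ - 1) = ∑_k F_k (ζ - 1)^k ∈ ℂ_p` — the tree's evaluation on the open disc
  (`PAdicPowerSeriesZeros`), and `ψ_ζ` is a primitive even Dirichlet character `χ` mod `p^{t+e₀}`
  (`e₀ = cyclotomicExponent p`) of `p`-power order with values in `ℂ_p` and `χ(γ) = ζ`.
* `p^{t+1}/𝔤(ψ_ζ^{-1}) = 𝔤(ψ_ζ)` (`ψ_ζ` even, `𝔤(ψ)𝔤(ψ̄) = ψ(-1) p^{t+1}`) and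
  `𝔤(ψ_ζ) · L(1, g ⊗ ψ_ζ^{-1}) = 𝔤(χ) L(g, χ̄, 1) = Ω⁺_f · ∑_a χ(a) [a/p^{t+e₀}]⁺_f = Ω⁺_f · ratTwistedSymbolSum f χ`
  (Birch's formula for the tree's rational plus symbols `[r]⁺_f = ratPlusSymbol f r`, normalised by the
  period `Ω⁺_f = plusPeriod f`; `ratTwistedSymbolSum_mul_plusPeriod`); `L(1, g)/Ω⁺_f = [0]⁺_f`.
* THE PERIOD. BSTW normalise by `Ω^+_{ω,γ}`; the tree by `Ω⁺_f`. For `g = f_E` both are non-zero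
  rational multiples of the real Néron period, so we WRITE `Ω^+_{ω,γ} = r · Ω⁺_f` with a parameter
  `r ∈ ℚ` and transcribe `L(1, g ⊗ ψ_ζ^{-1})·𝔤/Ω^+_{ω,γ} = r⁻¹ · ratTwistedSymbolSum f χ`. Hence
  `IsSignedCycLFunction f p ε r F` — "`F` is `𝓛^ε_{ω,γ}(g)` for any `(ω, γ)` with period ratio `r`" — is
  the printed characterising property, clause by clause: membership in `ℚ_p ⊗ Λ`; the value at the
  trivial character `F(0) = e^ε_p(1) · r⁻¹ · [0]⁺_f`; and for `t > 0`, `(-1)^t = ε`, every `ψ_ζ`: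
  `F(ζ - 1) = signedRootFactor ε t ζ · r⁻¹ · ratTwistedSymbolSum f ψ_ζ` with `signedRootFactor` the
  root-of-unity part of `e^ε_p(ζ)` exactly as displayed.

## What is proved (the dictionary)

* `IsSignedCycLFunction.of_isSignedPAdicLFunction`: Kobayashi's `L_p^ε` (`IsSignedPAdicLFunction f p ε L`:
  the tree's Pollack `L⁻` for `ε = 1`, `L⁺` for `ε = -1`, i.e. the components of any Pollack pair
  `IsPollackPair f p L⁺ L⁻` of `Summits/…/Supersingular/KobayashiMainConjecture.lean` through
  `isSignedPAdicLFunction_one_iff` / `_neg_one_iff`, and `kobayashiL ε L⁺ L⁻` there) satisfies BSTW's frame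
  with `r = 1`: Pollack's congruences evaluated at `ζ - 1` ARE the interpolation formula, the factors
  matching by `signedRootFactor_one_eq` / `_neg_one_eq` (`ω_t^∓(ζ-1)` = BSTW's cyclotomic products,
  `(-1)^{⌊t/2⌋+1}` = BSTW's signs), and the constant terms are `e^±_p(1)·[0]⁺_f`
  (`IsSignedPAdicLFunction.constantCoeff_eq_of_eq_one / _neg_one`).
* `IsSignedCycLFunction.C_mul_eq_C_mul`, `.unique`: two solutions with ratios `r₁, r₂ ≠ 0` satisfy
  `r₁ F₁ = r₂ F₂` (values agree at the infinitely many `ζ - 1` of parity `ε`; a non-zero element of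
  `Λ ⊗ ℚ_p` has finitely many zeros in the open disc) — the "unique" of Thm. 3.16.
* **`IsSignedCycLFunction.C_mul_eq_of_isSignedPAdicLFunction` (THE DICTIONARY): `r · 𝓛^ε_{ω,γ}(f_E) = L_p^ε`
  (Kobayashi's labelling; = Pollack's / the tree's `L^{-ε}`), i.e.
  `𝓛^+_{ω,γ} = (Ω⁺_f/Ω^+_{ω,γ}) · L⁻` and `𝓛^-_{ω,γ} = (Ω⁺_f/Ω^+_{ω,γ}) · L⁺` for a Pollack pair `(L⁺, L⁻)`.**
* `existsUnique_isSignedCycLFunction`: Thm. 3.16 for `g = f_E` (existence from Pollack's fact, any `r ≠ 0`).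
* `IsSignedCycLFunction.exists_isUnit_eq_of_norm_eq_one`: if `|r|_p = 1` then `𝓛^ε_{ω,γ} = u · L_p^ε` with
  `u ∈ ℤ_p^×` — the "`u ∈ Λ^×`" of the work item, and the integrality clause of Thm. 3.17 in this currency.

## What is NOT typed here (and why), for the consumer

The PERIOD-UNIT clause "`r = Ω^+_{ω,γ}/Ω⁺_f` is a `p`-adic unit for `ω` good and `γ^±` `𝒪`-generators
of `T^±`, under (irr_ℚ)" is NOT stated: the tree has no carrier for BSTW's `S_𝒪`, `T_𝒪^±`, `δ_g^±`, the
Eichler–Shimura map `per` (§2.2.6–2.2.9), so `Ω^+_{ω,γ}` itself cannot be named; a `def … : Prop` about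
it would be vacuous. Its printed sources, for the typer of the carriers (brief FILE B) or a planner item:
Lemma 2.5(ii) (`GorPer`, store `p0015` L15–31: under (irr_ℚ), `S_𝒪 = 𝒪·ω_g/c_g`, `T^±_𝒪 = 𝒪·δ^±_g/c_g`,
whence `Ω^±_{ω,γ} ∼_{𝒪_λ^×} Ω^±` for good `ω` and `γ^±` generators), Remark 2.3 (`EC-optperiod-rmk`,
`p0014` L131–134: the optimal periods `Ω^±` are a `ℤ_(p)`-basis of the Néron period lattice of a curve
`E_•` of the isogeny class, `E_• = E_1` under (irr_ℚ)), and on the tree's side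
`realPeriodRat_eq_unit_mul_plusPeriod` (`ModularCurvePeriodRatio.lean`: Néron period of `W` =
`p`-adic-unit rational multiple of `Ω⁺_f`, `p ≥ 5`, `E[p]` irreducible; Greenberg–Vatsal 2000 Rem. 3.4,
Manin constant) together with the prime-to-`p` isogeny `E_1 ~ W`. INTERFACE: downstream statements
take `(r : ℚ) (hr : ‖(r : ℚ_[p])‖ = 1)` next to `IsSignedCycLFunction f p ε r F`, and conclude with
`exists_isUnit_eq_of_norm_eq_one`. Also not typed: general coefficient fields `F_λ` (BSTW's `Λ_{𝒪_λ}`),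
the Coleman-map relation Thm. 3.17 (`Col^∘_ω(loc_p z_γ(g)) = 𝓛^∘_{ω,γ}(g)`), the products
`𝓛^∘_{ω,γ,γ'}(g/L)` of §3.4.3 (brief F3, needs FILE B).

## References

* [BurungaleSkinnerTianWan2024] A. Burungale, C. Skinner, Y. Tian, X. Wan, *Zeta elements for elliptic
  curves and applications*, arXiv:2409.01350v2 — Thm. 3.16, §3.4.1, Thm. 3.17, Lemma 2.5, Remark 2.3,
  §6.1.1 footnote (PREPRINT; claim-tagged).
* [Pollack2003] R. Pollack, *On the `p`-adic `L`-function of a modular form at a supersingular prime*,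
  Duke Math. J. 118 (2003) — Thm. 5.6, Cor. 5.11, Prop. 6.18, Lemma 4.7, §6.5.
* [Kobayashi2003] S. Kobayashi, *Iwasawa theory for elliptic curves at supersingular primes*, Invent.
  Math. 152 (2003) — Thm. 3.2, (3.4)–(3.6), p. 7 ("our sign … is opposite to that in [18]").
* [MazurTateTeitelbaum1986Invent] B. Mazur, J. Tate, J. Teitelbaum, Invent. Math. 84 (1986), §I.12–I.14.
-/

noncomputable section

open scoped MatrixGroups ModularForm

open CongruenceSubgroup Polynomial Literature.NumberTheory.EllipticCurves
  Literature.NumberTheory.EllipticCurves.ModularForms Literature.NumberTheory.EllipticCurves.Kobayashi2003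

namespace Literature.NumberTheory.EllipticCurves.BurungaleSkinnerTianWan2024

/-! ### §1 The interpolation factors `e^∘_p(ζ)` of Thm. 3.16 -/

section Factors

variable (p : ℕ)

/-- The ROOT-OF-UNITY PART of BSTW's interpolation factor `e^∘_p(ζ)` at a primitive `p^t`-th root of
unity `ζ`, `t > 0` (Thm. 3.16 of the arXiv v2 print = "Theorem 2.16" of the TeX-numbered store text): for `∘ = +` (`ε = 1`; `t` even)
`(-1)^{(t+2)/2} · ∏_{odd m = 1}^{t-1} Φ_{p^m}(ζ)^{-1}`, for `∘ = −` (`ε = -1`; `t` odd)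
`(-1)^{(t+1)/2} · ∏_{even m = 2}^{t-1} Φ_{p^m}(ζ)^{-1}`, `Φ_{p^m}` the `p^m`-th cyclotomic polynomial.
The remaining factor `p^{t+1}/𝔤(ψ_ζ^{-1})` of `e^∘_p(ζ)` (`𝔤` the usual Gauss sum, `ψ_ζ` the even
Dirichlet character of conductor `p^{t+1}` with `ψ_ζ(γ_cyc) = ζ`, §3.4.1) equals `𝔤(ψ_ζ)` and is
absorbed into Birch's twisted symbol sum in `IsSignedCycLFunction` below
(`𝔤(ψ_ζ) · L(1, g ⊗ ψ_ζ^{-1}) / Ω⁺_f = ratTwistedSymbolSum f ψ_ζ`, the tree's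
`ratTwistedSymbolSum_mul_plusPeriod`). The signs `∘` are those of [BSTW24] = KOBAYASHI's (footnote to
§6.1.1: "While our labelling of signs is opposite to [Po], it is consistent with the formulation of main
conjectures in [Ko]"), encoded as `ε = 1 ↦ +`, `ε = -1 ↦ −` exactly as in
`Kobayashi2003.IsSignedPAdicLFunction`.
[claim: BurungaleSkinnerTianWan2024, status: under-review] [cite: BurungaleSkinnerTianWan2024, Thm. 3.16 (label pcycQss, TeX body l.2251; the displays for e_p^+ and e_p^-) and §6.1.1 footnote (sign labelling)] -/
def signedRootFactor [Fact p.Prime] (ε : ℤˣ) (t : ℕ) (ζ : ℂ_[p]) : ℂ_[p] :=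
  if ε = 1 then
    (-1) ^ ((t + 2) / 2) *
      (∏ m ∈ (Finset.Icc 1 (t - 1)).filter Odd, (cyclotomic (p ^ m) ℂ_[p]).eval ζ)⁻¹
  else
    (-1) ^ ((t + 1) / 2) *
      (∏ m ∈ (Finset.Icc 2 (t - 1)).filter Even, (cyclotomic (p ^ m) ℂ_[p]).eval ζ)⁻¹

/-- BSTW's interpolation factor at the TRIVIAL character (`ζ = 1`, `t = 0`) of Thm. 3.16:
`e^+_p(1) = 2`, `e^-_p(1) = p - 1` (these are Kobayashi's constants `L_p^+(E,0) = 2·L(E,1)/Ω_E`,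
`L_p^-(E,0) = (p-1)·L(E,1)/Ω_E`, Invent. Math. 152 (2003) (3.6), confirming the sign dictionary).
[claim: BurungaleSkinnerTianWan2024, status: under-review] [cite: BurungaleSkinnerTianWan2024, Thm. 3.16 (label pcycQss; the cases t = 0 of e_p^±)]
[cite: Kobayashi2003, (3.6) (p. 7)] -/
def signedTrivialFactor (ε : ℤˣ) : ℚ :=
  if ε = 1 then 2 else (p : ℚ) - 1

variable {p}

/-- Unfolding `signedRootFactor` at `ε = 1` (the display for `e_p^+`). [cite: BurungaleSkinnerTianWan2024, Thm. 3.16 (label pcycQss)] -/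
theorem signedRootFactor_one [Fact p.Prime] (t : ℕ) (ζ : ℂ_[p]) :
    signedRootFactor p 1 t ζ = (-1) ^ ((t + 2) / 2) *
      (∏ m ∈ (Finset.Icc 1 (t - 1)).filter Odd, (cyclotomic (p ^ m) ℂ_[p]).eval ζ)⁻¹ := by
  simp [signedRootFactor]

/-- Unfolding `signedRootFactor` at `ε = -1` (the display for `e_p^-`). [cite: BurungaleSkinnerTianWan2024, Thm. 3.16 (label pcycQss)] -/
theorem signedRootFactor_neg_one [Fact p.Prime] (t : ℕ) (ζ : ℂ_[p]) :
    signedRootFactor p (-1) t ζ = (-1) ^ ((t + 1) / 2) *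
      (∏ m ∈ (Finset.Icc 2 (t - 1)).filter Even, (cyclotomic (p ^ m) ℂ_[p]).eval ζ)⁻¹ := by
  have h : ((-1 : ℤˣ) = 1) ↔ False := by decide
  simp [signedRootFactor, h]

/-- `e^+_p(1) = 2` (= Kobayashi's constant for `L_p^+(E,0)`). [cite: Kobayashi2003, (3.6) (p. 7)] -/
@[simp] theorem signedTrivialFactor_one : signedTrivialFactor p 1 = 2 := by
  simp [signedTrivialFactor]

/-- `e^-_p(1) = p - 1` (= Kobayashi's constant for `L_p^-(E,0)`). [cite: Kobayashi2003, (3.6) (p. 7)] -/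
@[simp] theorem signedTrivialFactor_neg_one : signedTrivialFactor p (-1) = (p : ℚ) - 1 := by
  have h : ((-1 : ℤˣ) = 1) ↔ False := by decide
  simp [signedTrivialFactor, h]

/-- Pollack's half `ω_t^-(ζ - 1) = ∏_{1 ≤ 2k-1 ≤ t} Φ_{p^{2k-1}}(ζ)` is BSTW's product
`∏_{odd m = 1}^{t-1} Φ_{p^m}(ζ)` when `t` is even (reindex `m = 2k - 1`). [cite: Pollack2003, §6.5 (display before Prop. 6.18)] -/
theorem eval₂_cyclotomicOmegaMinus_eq_prod_filter_odd [Fact p.Prime] {t : ℕ} (ht : Even t) (ζ : ℂ_[p]) :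
    (cyclotomicOmegaMinus p t).eval₂ (algebraMap ℤ ℂ_[p]) (ζ - 1) =
      ∏ m ∈ (Finset.Icc 1 (t - 1)).filter Odd, (cyclotomic (p ^ m) ℂ_[p]).eval ζ := by
  rw [cyclotomicOmegaMinus, eval₂_finsetProd]
  have himage : (Finset.Icc 1 (t - 1)).filter Odd =
      (Finset.Icc 1 ((t + 1) / 2)).image (fun k ↦ 2 * k - 1) := by
    ext m
    simp only [Finset.mem_filter, Finset.mem_Icc, Finset.mem_image]
    constructor
    · rintro ⟨⟨h1, h2⟩, ⟨j, hj⟩⟩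
      obtain ⟨i, hi⟩ := ht
      exact ⟨j + 1, ⟨by omega, by omega⟩, by omega⟩
    · rintro ⟨k, ⟨hk1, hk2⟩, rfl⟩
      obtain ⟨i, hi⟩ := ht
      exact ⟨⟨by omega, by omega⟩, ⟨k - 1, by omega⟩⟩
  rw [himage, Finset.prod_image (fun a ha b hb hab ↦ by
    simp only [Finset.coe_Icc, Set.mem_Icc] at ha hb; omega)]
  refine Finset.prod_congr rfl fun k _ ↦ ?_
  rw [eval₂_comp, eval₂_add, eval₂_X, eval₂_one, sub_add_cancel, eval₂_eq_eval_map, map_cyclotomic]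

/-- Pollack's half `ω_t^+(ζ - 1) = ∏_{1 ≤ 2k ≤ t} Φ_{p^{2k}}(ζ)` is BSTW's product
`∏_{even m = 2}^{t-1} Φ_{p^m}(ζ)` when `t` is odd (reindex `m = 2k`). [cite: Pollack2003, §6.5 (display before Prop. 6.18)] -/
theorem eval₂_cyclotomicOmegaPlus_eq_prod_filter_even [Fact p.Prime] {t : ℕ} (ht : Odd t) (ζ : ℂ_[p]) :
    (cyclotomicOmegaPlus p t).eval₂ (algebraMap ℤ ℂ_[p]) (ζ - 1) =
      ∏ m ∈ (Finset.Icc 2 (t - 1)).filter Even, (cyclotomic (p ^ m) ℂ_[p]).eval ζ := by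
  rw [cyclotomicOmegaPlus, eval₂_finsetProd]
  have himage : (Finset.Icc 2 (t - 1)).filter Even =
      (Finset.Icc 1 (t / 2)).image (fun k ↦ 2 * k) := by
    ext m
    simp only [Finset.mem_filter, Finset.mem_Icc, Finset.mem_image]
    constructor
    · rintro ⟨⟨h1, h2⟩, ⟨j, hj⟩⟩
      obtain ⟨i, hi⟩ := ht
      exact ⟨j, ⟨by omega, by omega⟩, by omega⟩
    · rintro ⟨k, ⟨hk1, hk2⟩, rfl⟩
      obtain ⟨i, hi⟩ := ht
      exact ⟨⟨by omega, by omega⟩, ⟨k, by omega⟩⟩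
  rw [himage, Finset.prod_image (fun a ha b hb hab ↦ by
    simp only [Finset.coe_Icc, Set.mem_Icc] at ha hb; omega)]
  refine Finset.prod_congr rfl fun k _ ↦ ?_
  rw [eval₂_comp, eval₂_add, eval₂_X, eval₂_one, sub_add_cancel, eval₂_eq_eval_map, map_cyclotomic]

/-- For `t` even, `e^+`'s root-of-unity part is `(-1)^{⌊t/2⌋+1} · ω_t^-(ζ-1)^{-1}` (Pollack's
normalisation, as in `Kobayashi2003.IsSignedPAdicLFunction`). [cite: Pollack2003, Prop. 6.18 and Lemma 4.7] -/
theorem signedRootFactor_one_eq [Fact p.Prime] {t : ℕ} (ht : Even t) (ζ : ℂ_[p]) :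
    signedRootFactor p 1 t ζ =
      (-1) ^ (t / 2 + 1) * ((cyclotomicOmegaMinus p t).eval₂ (algebraMap ℤ ℂ_[p]) (ζ - 1))⁻¹ := by
  rw [signedRootFactor_one, eval₂_cyclotomicOmegaMinus_eq_prod_filter_odd ht]
  obtain ⟨i, rfl⟩ := ht
  congr 2
  omega

/-- For `t` odd, `e^-`'s root-of-unity part is `(-1)^{⌊t/2⌋+1} · ω_t^+(ζ-1)^{-1}`. [cite: Pollack2003, Prop. 6.18 and Lemma 4.7] -/
theorem signedRootFactor_neg_one_eq [Fact p.Prime] {t : ℕ} (ht : Odd t) (ζ : ℂ_[p]) :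
    signedRootFactor p (-1) t ζ =
      (-1) ^ (t / 2 + 1) * ((cyclotomicOmegaPlus p t).eval₂ (algebraMap ℤ ℂ_[p]) (ζ - 1))⁻¹ := by
  rw [signedRootFactor_neg_one, eval₂_cyclotomicOmegaPlus_eq_prod_filter_even ht]
  obtain ⟨i, rfl⟩ := ht
  congr 2
  omega

end Factors

/-! ### §2 Thm. 3.16 as an interpolation frame in the tree's currency -/

section Frame

variable {N : ℕ} (f : CuspForm (Gamma0 N) 2) (p : ℕ) [Fact p.Prime]

/-- **`F` is BSTW's signed cyclotomic `p`-adic `L`-function `𝓛^∘_{ω,γ}(g)` of Thm. 3.16**, for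
`g = f` a RATIONAL newform with `a_p = 0`, the sign `∘` (`ε = 1 ↦ +`, `ε = -1 ↦ −`, BSTW's = Kobayashi's
labelling) and a choice `(ω, γ)` whose period is `Ω⁺_{ω,γ} = r · Ω⁺_f` (`r ∈ ℚ^×`; `Ω⁺_f = plusPeriod f`
the tree's period of the normalised symbols `[·]⁺_f`): the element `F ∈ ℚ_p ⊗_{ℤ_p} Λ`
(`MemIwasawaRat`; `Λ = ℤ_p⟦T⟧`, `T = γ_cyc - 1` with `ε(γ_cyc) = cyclotomicGenerator p`) such that,
writing `φ_ζ(F) = F(ζ - 1) = ∑_k F_k (ζ-1)^k` for `ζ` a primitive `p^t`-th root of unity,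
* `φ_1(F) = e^∘_p(1) · L(1, g)/Ω⁺_{ω,γ}`, i.e. `F(0) = e^∘_p(1) · r⁻¹ · [0]⁺_f`
  (`[0]⁺_f = L(f,1)/Ω⁺_f`; `e^+_p(1) = 2`, `e^-_p(1) = p - 1`), and
* for every `t > 0` with `(-1)^t = ε` and every `ψ = ψ_ζ` (primitive even Dirichlet character of
  conductor `p^{t+e₀}` of `p`-power order with values in `ℂ_p`, `ζ = ψ(γ)`):
  `φ_ζ(F) = e^∘_p(ζ) · L(1, g ⊗ ψ_ζ^{-1})/Ω⁺_{ω,γ}`, i.e.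
  `F(ζ - 1) = signedRootFactor ε t ζ · r⁻¹ · ∑_a ψ(a) [a/p^{t+e₀}]⁺_f`
  (`p^{t+1}/𝔤(ψ_ζ^{-1}) · L(1, g ⊗ ψ_ζ^{-1}) = 𝔤(ψ_ζ) L(g, ψ̄_ζ, 1) = Ω⁺_f · ratTwistedSymbolSum f ψ_ζ`
  for even `ψ_ζ`, Birch's formula).
Verbatim the characterising property printed in Thm. 3.16 ("There exists an unique
`𝓛^∘_{ω,γ}(g) ∈ ℚ_p ⊗_{ℤ_p} Λ_{𝒪_λ}` such that `φ_ζ(𝓛^∘_{ω,γ}(g)) = e^∘_p(ζ) · L(1, g ⊗ ψ_ζ^{-1})/Ω^+_{ω,γ}`")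
specialised to `𝒪_λ = ℤ_p` (rational newform) and written through the period ratio `r`; a predicate,
nothing asserted. Existence, uniqueness and the dictionary with the tree's Pollack/Kobayashi
functions are PROVED below. -- TODO(general form): coefficient field `F_λ ≠ ℚ_p` (`Λ_{𝒪_λ}`).
[claim: BurungaleSkinnerTianWan2024, status: under-review] [cite: BurungaleSkinnerTianWan2024, Thm. 3.16 (label pcycQss, TeX body l.2251) with §3.4.1 (label characters-cyc: ψ_ζ, φ_ζ) and §6.1.1 footnote (signs)]
[cite: Kobayashi2003, Thm. 3.2 and (3.4)–(3.6) (p. 7)] -/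
def IsSignedCycLFunction (ε : ℤˣ) (r : ℚ) (F : PowerSeries ℚ_[p]) : Prop :=
  MemIwasawaRat p F ∧
    PowerSeries.constantCoeff F =
      ((signedTrivialFactor p ε * (r⁻¹ * ratPlusSymbol f 0) : ℚ) : ℚ_[p]) ∧
    ∀ t : ℕ, 0 < t → (t : ℤ).negOnePow = ε →
      ∀ χ : DirichletCharacter ℂ_[p] (p ^ (t + cyclotomicExponent p)), χ.IsPrimitive → χ.Even →
        (∃ j : ℕ, orderOf χ = p ^ j) →
          HasSum (fun k ↦ algebraMap ℚ_[p] ℂ_[p] (PowerSeries.coeff k F) *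
              (χ (cyclotomicGenerator p : ZMod (p ^ (t + cyclotomicExponent p))) - 1) ^ k)
            (signedRootFactor p ε t
                (χ (cyclotomicGenerator p : ZMod (p ^ (t + cyclotomicExponent p)))) *
              ((r : ℂ_[p])⁻¹ * ratTwistedSymbolSum f χ))

variable {f p}

/-- The membership clause `F ∈ ℚ_p ⊗_{ℤ_p} Λ`. [cite: MazurTateTeitelbaum1986Invent, §I.12] -/
theorem IsSignedCycLFunction.memIwasawaRat {ε : ℤˣ} {r : ℚ} {F : PowerSeries ℚ_[p]}
    (h : IsSignedCycLFunction f p ε r F) : MemIwasawaRat p F :=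
  h.1

end Frame

/-! ### §3 Evaluation bookkeeping -/

section Eval

variable {p : ℕ} [Fact p.Prime]

/-- The coefficients of `ι L`, `L ∈ Λ`, sent to `ℂ_p`. [folklore] -/
private theorem algebraMap_coeff_iwasawaToPowerSeries (L : IwasawaAlgebra p) (k : ℕ) :
    algebraMap ℚ_[p] ℂ_[p] (PowerSeries.coeff k (iwasawaToPowerSeries p L)) =
      ((algebraMap ℚ_[p] ℂ_[p]).comp (algebraMap ℤ_[p] ℚ_[p])) (PowerSeries.coeff k L) := by
  simp only [RingHom.comp_apply, iwasawaToPowerSeries, PowerSeries.coeff_map]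

/-- Primitive `p^n`-th roots of unity exist in `ℂ_p`. [folklore] -/
private theorem exists_isPrimitiveRoot_padicComplex (n : ℕ) :
    ∃ ζ : ℂ_[p], IsPrimitiveRoot ζ (p ^ n) := by
  have hpos : 0 < p ^ n := pow_pos (Fact.out : p.Prime).pos n
  obtain ⟨ζ, hζ⟩ := IsAlgClosed.exists_root (cyclotomic (p ^ n) ℂ_[p])
    (degree_cyclotomic_pos (p ^ n) ℂ_[p] hpos).ne'
  exact ⟨ζ, (isRoot_cyclotomic_iff_charZero hpos).mp hζ⟩

end Eval

/-! ### §4 Pollack's / Kobayashi's `L_p^ε` satisfies BSTW's frame with `Ω⁺_{ω,γ} = Ω⁺_f` -/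

section Dictionary

variable {W : WeierstrassCurve ℚ} [W.IsElliptic] [W.IsGloballyMinimal] {N : ℕ} [NeZero N]
  {f : CuspForm (Gamma0 N) 2} {p : ℕ} [Fact p.Prime]

/-- **Kobayashi's `L_p^ε` (the tree's Pollack `L⁻` for `ε = 1`, `L⁺` for `ε = -1`) is BSTW's `𝓛^ε`
in the normalisation `Ω⁺_{ω,γ} = Ω⁺_f`** (`r = 1`): for `p` odd, `f` the newform of `E = W` with good
reduction at `p` and `a_p = 0`, every `L ∈ Λ` with `IsSignedPAdicLFunction f p ε L` satisfies
`IsSignedCycLFunction f p ε 1 (ι L)`. The interpolation at `t > 0` is Pollack's congruence evaluated at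
`ζ - 1` (`IsCongrModOmega.eval₂_eq`, `eval₂_mazurTateElement_eq_ratTwistedSymbolSum`; the factors agree
by `signedRootFactor_one_eq` / `_neg_one_eq`); at `t = 0` it is the constant term
`L(0) = 2·[0]⁺_f` resp. `(p-1)·[0]⁺_f` (`IsSignedPAdicLFunction.constantCoeff_eq_of_eq_one/_neg_one`),
matching `e^±_p(1)` — which is the sign dictionary: BSTW `+` = Kobayashi `+` = Pollack / the tree's `L⁻`.
[cite: Kobayashi2003, Thm. 3.2 and (3.4)–(3.6) (p. 7)] [cite: Pollack2003, Prop. 6.18 and Lemma 4.7]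
[claim: BurungaleSkinnerTianWan2024, status: under-review] [cite: BurungaleSkinnerTianWan2024, Thm. 3.16 and §6.1.1 footnote] -/
theorem IsSignedCycLFunction.of_isSignedPAdicLFunction (hp2 : p ≠ 2) (hf : IsNewformOf W f)
    (hgood : W.HasGoodReductionAtPrime p) (hap : W.frobeniusTrace p = 0) {ε : ℤˣ}
    {L : IwasawaAlgebra p} (hL : IsSignedPAdicLFunction f p ε L) :
    IsSignedCycLFunction f p ε 1 (iwasawaToPowerSeries p L) := by
  refine ⟨memIwasawaRat_iwasawaToPowerSeries p L, ?_, fun t ht hpar χ hχ hev hord ↦ ?_⟩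
  · -- the trivial character
    have hc : PowerSeries.constantCoeff (iwasawaToPowerSeries p L) =
        ((PowerSeries.constantCoeff L : ℤ_[p]) : ℚ_[p]) := by
      rw [iwasawaToPowerSeries, ← PowerSeries.coeff_zero_eq_constantCoeff_apply, PowerSeries.coeff_map,
        PowerSeries.coeff_zero_eq_constantCoeff_apply, PadicInt.algebraMap_apply]
    rw [hc]
    rcases Int.units_eq_one_or ε with rfl | rfl
    · rw [hL.constantCoeff_eq_of_eq_one hp2 hf hgood hap, signedTrivialFactor_one, inv_one, one_mul]
    · rw [hL.constantCoeff_eq_of_eq_neg_one hp2 hf hgood hap, signedTrivialFactor_neg_one, inv_one,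
        one_mul]
  · -- wild characters
    set ζ : ℂ_[p] := χ (cyclotomicGenerator p : ZMod (p ^ (t + cyclotomicExponent p))) with hζdef
    have hordζ : orderOf ζ = p ^ t := by
      have h1 := orderOf_apply_cyclotomicGenerator (m := t + cyclotomicExponent p)
        (Nat.lt_add_of_pos_left ht) χ hχ hev hord
      rwa [Nat.add_sub_cancel] at h1
    have hprim : IsPrimitiveRoot ζ (p ^ t) := hordζ ▸ IsPrimitiveRoot.orderOf ζ
    have hpow : ζ ^ p ^ t = 1 := hordζ ▸ pow_orderOf_eq_one ζ
    have hz : ‖ζ - 1‖ < 1 := norm_sub_one_lt_one_of_pow_prime_pow_eq_one hpow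
    have hzn : (1 + (ζ - 1)) ^ p ^ t = 1 := by rwa [add_sub_cancel]
    have hθ := eval₂_mazurTateElement_eq_ratTwistedSymbolSum f χ hev hord
    have hsum := (summable_map_coeff_mul_pow ((algebraMap ℚ_[p] ℂ_[p]).comp (algebraMap ℤ_[p] ℚ_[p]))
      (norm_algebraMap_coeff_le_one L) hz).hasSum
    have hfun : (fun k ↦ algebraMap ℚ_[p] ℂ_[p] (PowerSeries.coeff k (iwasawaToPowerSeries p L)) *
        (ζ - 1) ^ k) = fun k ↦ ((algebraMap ℚ_[p] ℂ_[p]).comp (algebraMap ℤ_[p] ℚ_[p]))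
          (PowerSeries.coeff k L) * (ζ - 1) ^ k := by
      funext k; rw [algebraMap_coeff_iwasawaToPowerSeries]
    rw [hfun, Rat.cast_one, inv_one, one_mul]
    have hsq : ((-1 : ℂ_[p]) ^ (t / 2 + 1)) * (-1) ^ (t / 2 + 1) = 1 := by
      rw [← pow_add, ← two_mul, pow_mul, neg_one_sq, one_pow]
    rcases Int.units_eq_one_or ε with rfl | rfl
    · have he : Even t := by rwa [Int.negOnePow_eq_one_iff, Int.even_coe_nat] at hpar
      have e₁ := ((isSignedPAdicLFunction_one_iff f p L).mp hL t he).eval₂_eq hz hzn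
      rw [hθ, eval₂_mul, eval₂_pow, eval₂_neg, eval₂_one] at e₁
      have hω := eval₂_cyclotomicOmegaMinus_ne_zero (p := p) he hprim
      set S : ℂ_[p] := ∑' k, ((algebraMap ℚ_[p] ℂ_[p]).comp (algebraMap ℤ_[p] ℚ_[p]))
        (PowerSeries.coeff k L) * (ζ - 1) ^ k with hSdef
      set ω : ℂ_[p] := (cyclotomicOmegaMinus p t).eval₂ (algebraMap ℤ ℂ_[p]) (ζ - 1) with hωdef
      convert hsum using 1
      rw [signedRootFactor_one_eq he, ← hωdef, e₁]
      calc (-1 : ℂ_[p]) ^ (t / 2 + 1) * ω⁻¹ * ((-1) ^ (t / 2 + 1) * ω * S)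
          = ((-1 : ℂ_[p]) ^ (t / 2 + 1) * (-1) ^ (t / 2 + 1)) * (ω⁻¹ * ω) * S := by ring
        _ = S := by rw [hsq, inv_mul_cancel₀ hω, one_mul, one_mul]
    · have ho : Odd t := by rwa [Int.negOnePow_eq_neg_one_iff, Int.odd_coe_nat] at hpar
      have e₁ := ((isSignedPAdicLFunction_neg_one_iff f p L).mp hL t ho).eval₂_eq hz hzn
      rw [hθ, eval₂_mul, eval₂_pow, eval₂_neg, eval₂_one] at e₁
      have hω := eval₂_cyclotomicOmegaPlus_ne_zero (p := p) ho hprim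
      set S : ℂ_[p] := ∑' k, ((algebraMap ℚ_[p] ℂ_[p]).comp (algebraMap ℤ_[p] ℚ_[p]))
        (PowerSeries.coeff k L) * (ζ - 1) ^ k with hSdef
      set ω : ℂ_[p] := (cyclotomicOmegaPlus p t).eval₂ (algebraMap ℤ ℂ_[p]) (ζ - 1) with hωdef
      convert hsum using 1
      rw [signedRootFactor_neg_one_eq ho, ← hωdef, e₁]
      calc (-1 : ℂ_[p]) ^ (t / 2 + 1) * ω⁻¹ * ((-1) ^ (t / 2 + 1) * ω * S)
          = ((-1 : ℂ_[p]) ^ (t / 2 + 1) * (-1) ^ (t / 2 + 1)) * (ω⁻¹ * ω) * S := by ring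
        _ = S := by rw [hsq, inv_mul_cancel₀ hω, one_mul, one_mul]

end Dictionary

/-! ### §5 Uniqueness (Thm. 3.16 "there exists an unique") and the dictionary `r · 𝓛^ε_{ω,γ} = L_p^ε` -/

section Unique

variable {N : ℕ} {f : CuspForm (Gamma0 N) 2} {p : ℕ} [Fact p.Prime]

/-- Cancelling the period ratio in an interpolation value. [folklore] -/
private theorem algebraMap_ratCast_mul_cancel {r : ℚ} (hr : r ≠ 0) (A B : ℂ_[p]) :
    algebraMap ℚ_[p] ℂ_[p] (r : ℚ_[p]) * (A * ((r : ℂ_[p])⁻¹ * B)) = A * B := by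
  rw [map_ratCast]
  have hr' : (r : ℂ_[p]) ≠ 0 := by exact_mod_cast hr
  field_simp

/-- **Two solutions of BSTW's frame for the same sign, in the normalisations `r₁`, `r₂`, satisfy
`r₁ F₁ = r₂ F₂`**: both `r_i F_i` take the value `e(ζ) · ∑_a ψ_ζ(a)[a/p^{t+e₀}]⁺_f` at `ζ - 1` for
every primitive `p^t`-th root of unity `ζ ∈ ℂ_p` with `t > 0`, `(-1)^t = ε` (a character `ψ_ζ` with
`ψ_ζ(γ) = ζ` exists, `exists_character_apply_cyclotomicGenerator_eq`), and a non-zero element of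
`ℚ_p ⊗ Λ` has only finitely many zeros in the open unit disc (`MemIwasawaRat.finite_setOf_hasSum_zero`;
Mazur–Tate–Teitelbaum 1986 §I.12). This is the uniqueness clause of Thm. 3.16 together with its
(in)dependence on the period. [cite: MazurTateTeitelbaum1986Invent, §I.12–I.14]
[claim: BurungaleSkinnerTianWan2024, status: under-review] [cite: BurungaleSkinnerTianWan2024, Thm. 3.16 ("There exists an unique")] -/
theorem IsSignedCycLFunction.C_mul_eq_C_mul {ε : ℤˣ} {r₁ r₂ : ℚ} {F₁ F₂ : PowerSeries ℚ_[p]}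
    (hr₁ : r₁ ≠ 0) (hr₂ : r₂ ≠ 0) (h₁ : IsSignedCycLFunction f p ε r₁ F₁)
    (h₂ : IsSignedCycLFunction f p ε r₂ F₂) :
    PowerSeries.C (r₁ : ℚ_[p]) * F₁ = PowerSeries.C (r₂ : ℚ_[p]) * F₂ := by
  have hp : p.Prime := Fact.out
  by_contra hne
  set D : PowerSeries ℚ_[p] :=
    PowerSeries.C (r₁ : ℚ_[p]) * F₁ - PowerSeries.C (r₂ : ℚ_[p]) * F₂ with hDdef
  have hD0 : D ≠ 0 := sub_ne_zero.mpr hne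
  have hD : MemIwasawaRat p D :=
    (h₁.1.C_mul _).sub (h₂.1.C_mul _)
  have hfin := hD.finite_setOf_hasSum_zero hD0
  -- an injective family of levels `j k + 1` of parity `ε`
  obtain ⟨j, hjinj, hjpar⟩ : ∃ j : ℕ → ℕ, Function.Injective j ∧
      ∀ k, ((j k + 1 : ℕ) : ℤ).negOnePow = ε := by
    rcases Int.units_eq_one_or ε with rfl | rfl
    · refine ⟨fun k ↦ 2 * k + 1, fun a b h ↦ by simpa using h, fun k ↦ ?_⟩
      rw [Int.negOnePow_eq_one_iff, Int.even_coe_nat]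
      exact ⟨k + 1, by ring⟩
    · refine ⟨fun k ↦ 2 * k, fun a b h ↦ by simpa using h, fun k ↦ ?_⟩
      rw [Int.negOnePow_eq_neg_one_iff, Int.odd_coe_nat]
      exact ⟨k, rfl⟩
  choose ζ hζ using fun k ↦ exists_isPrimitiveRoot_padicComplex (p := p) (j k + 1)
  choose χ hχ using fun k ↦ exists_character_apply_cyclotomicGenerator_eq (p := p) (j k) (hζ k)
  -- every `ζ_k - 1` is a zero of `D` in the open unit disc
  have hmem : ∀ k, ζ k - 1 ∈ {z : ℂ_[p] | ‖z‖ < 1 ∧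
      HasSum (fun i ↦ algebraMap ℚ_[p] ℂ_[p] (PowerSeries.coeff i D) * z ^ i) 0} := by
    intro k
    have hz : ‖ζ k - 1‖ < 1 := norm_sub_one_lt_one_of_pow_prime_pow_eq_one (hζ k).pow_eq_one
    refine ⟨hz, ?_⟩
    obtain ⟨hprim, hev, hord, happly⟩ := hχ k
    have e₁ := h₁.2.2 (j k + 1) (Nat.succ_pos _) (hjpar k) (χ k) hprim hev hord
    have e₂ := h₂.2.2 (j k + 1) (Nat.succ_pos _) (hjpar k) (χ k) hprim hev hord
    rw [happly] at e₁ e₂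
    have s₁ := hasSum_eval_C_mul (r₁ : ℚ_[p]) e₁
    have s₂ := hasSum_eval_C_mul (r₂ : ℚ_[p]) e₂
    rw [algebraMap_ratCast_mul_cancel hr₁] at s₁
    rw [algebraMap_ratCast_mul_cancel hr₂] at s₂
    have hsub := s₁.sub s₂
    rw [sub_self] at hsub
    refine hsub.congr_fun fun i ↦ ?_
    rw [hDdef, map_sub, map_sub, sub_mul]
  -- the zeros are pairwise distinct
  have hinjζ : Function.Injective fun k ↦ ζ k - 1 := by
    intro a b hab
    have hζab : ζ a = ζ b := sub_left_injective hab
    have ho : p ^ (j a + 1) = p ^ (j b + 1) := by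
      rw [(hζ a).eq_orderOf, (hζ b).eq_orderOf, hζab]
    have := Nat.pow_right_injective hp.two_le ho
    exact hjinj (by omega)
  exact hfin.not_infinite
    ((Set.infinite_range_of_injective hinjζ).mono (Set.range_subset_iff.mpr hmem))

/-- **Uniqueness of `𝓛^∘_{ω,γ}(g)`** (Thm. 3.16: "there exists an unique"): for a fixed period ratio
`r ≠ 0` and sign, at most one `F ∈ ℚ_p ⊗ Λ` has the interpolation property.
[cite: MazurTateTeitelbaum1986Invent, §I.12–I.14] [claim: BurungaleSkinnerTianWan2024, status: under-review] [cite: BurungaleSkinnerTianWan2024, Thm. 3.16] -/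
theorem IsSignedCycLFunction.unique {ε : ℤˣ} {r : ℚ} {F₁ F₂ : PowerSeries ℚ_[p]} (hr : r ≠ 0)
    (h₁ : IsSignedCycLFunction f p ε r F₁) (h₂ : IsSignedCycLFunction f p ε r F₂) : F₁ = F₂ := by
  have h := h₁.C_mul_eq_C_mul hr hr h₂
  have hr' : (r : ℚ_[p]) ≠ 0 := by exact_mod_cast hr
  have hcancel : ∀ F : PowerSeries ℚ_[p],
      PowerSeries.C ((r : ℚ_[p])⁻¹) * (PowerSeries.C (r : ℚ_[p]) * F) = F := fun F ↦ by
    rw [← mul_assoc, ← map_mul, inv_mul_cancel₀ hr', map_one, one_mul]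
  rw [← hcancel F₁, h, hcancel]

variable {W : WeierstrassCurve ℚ} [W.IsElliptic] [W.IsGloballyMinimal] [NeZero N]

/-- **The dictionary** (BSTW Thm. 3.16 ↔ Pollack 2003 / Kobayashi 2003, for `g = f_E`): if `F` is
BSTW's `𝓛^ε_{ω,γ}(g)` for a choice `(ω, γ)` with `Ω⁺_{ω,γ} = r · Ω⁺_f`, `r ≠ 0`, and `L` is Kobayashi's
`L_p^ε(E)` (the tree's Pollack `L⁻` for `ε = 1`, `L⁺` for `ε = -1`: `IsSignedPAdicLFunction f p ε L`,
e.g. the components of a Pollack pair), then **`r · F = L`** in `ℚ_p⟦T⟧` — same sign (BSTW's labelling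
is Kobayashi's, opposite to Pollack's: footnote to §6.1.1), and the only difference is the period:
`𝓛^ε_{ω,γ}(g) = (Ω⁺_f/Ω⁺_{ω,γ}) · L_p^ε`. For `p` odd, `f` the newform of `E = W`, good reduction at
`p`, `a_p = 0`. [cite: Kobayashi2003, Thm. 3.2 and (3.4)–(3.6) (p. 7)] [cite: Pollack2003, Thm. 5.6, Cor. 5.11 and Prop. 6.18]
[claim: BurungaleSkinnerTianWan2024, status: under-review] [cite: BurungaleSkinnerTianWan2024, Thm. 3.16 and §6.1.1 footnote (arXiv:2409.01350v2)] -/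
theorem IsSignedCycLFunction.C_mul_eq_of_isSignedPAdicLFunction (hp2 : p ≠ 2) (hf : IsNewformOf W f)
    (hgood : W.HasGoodReductionAtPrime p) (hap : W.frobeniusTrace p = 0) {ε : ℤˣ} {r : ℚ}
    {F : PowerSeries ℚ_[p]} {L : IwasawaAlgebra p} (hr : r ≠ 0)
    (hF : IsSignedCycLFunction f p ε r F) (hL : IsSignedPAdicLFunction f p ε L) :
    PowerSeries.C (r : ℚ_[p]) * F = iwasawaToPowerSeries p L := by
  have h := hF.C_mul_eq_C_mul hr one_ne_zero
    (IsSignedCycLFunction.of_isSignedPAdicLFunction hp2 hf hgood hap hL)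
  rwa [Rat.cast_one, map_one, one_mul] at h

/-- **Existence in every normalisation**: `r⁻¹ · L_p^ε` is BSTW's `𝓛^ε_{ω,γ}` for `Ω⁺_{ω,γ} = r Ω⁺_f`
(for `r = 0` both sides degenerate to `0`, Lean's `0⁻¹ = 0`).
[cite: Pollack2003, Thm. 5.6 and Prop. 6.18] [claim: BurungaleSkinnerTianWan2024, status: under-review] [cite: BurungaleSkinnerTianWan2024, Thm. 3.16] -/
theorem IsSignedCycLFunction.C_inv_mul_of_isSignedPAdicLFunction (hp2 : p ≠ 2)
    (hf : IsNewformOf W f) (hgood : W.HasGoodReductionAtPrime p) (hap : W.frobeniusTrace p = 0)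
    {ε : ℤˣ} {L : IwasawaAlgebra p} (hL : IsSignedPAdicLFunction f p ε L) (r : ℚ) :
    IsSignedCycLFunction f p ε r
      (PowerSeries.C ((r : ℚ_[p])⁻¹) * iwasawaToPowerSeries p L) := by
  have h1 := IsSignedCycLFunction.of_isSignedPAdicLFunction hp2 hf hgood hap hL
  refine ⟨h1.1.C_mul _, ?_, fun t ht hpar χ hχ hev hord ↦ ?_⟩
  · rw [← PowerSeries.coeff_zero_eq_constantCoeff_apply, PowerSeries.coeff_C_mul,
      PowerSeries.coeff_zero_eq_constantCoeff_apply, h1.2.1]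
    push_cast
    ring
  · have e := h1.2.2 t ht hpar χ hχ hev hord
    have s := hasSum_eval_C_mul ((r : ℚ_[p])⁻¹) e
    convert s using 1
    rw [map_inv₀, map_ratCast, Rat.cast_one, inv_one, one_mul]
    ring

/-- **Thm. 3.16 for `g = f_E` (existence and uniqueness), the tree's Pollack fact granted**: for `p`
odd, `f` the newform of `E = W` with good reduction at `p` and `a_p = 0`, either sign `ε` and every
period ratio `r ≠ 0`, there is EXACTLY ONE `F ∈ ℚ_p ⊗ Λ` with BSTW's interpolation property — the
signed cyclotomic `p`-adic `L`-function `𝓛^ε_{ω,γ}(g)` of any `(ω, γ)` with `Ω⁺_{ω,γ} = r Ω⁺_f`.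
[cite: Pollack2003, Thm. 5.6, Cor. 5.11 and Prop. 6.18] [cite: MazurTateTeitelbaum1986Invent, §I.12–I.14]
[claim: BurungaleSkinnerTianWan2024, status: under-review] [cite: BurungaleSkinnerTianWan2024, Thm. 3.16] -/
theorem existsUnique_isSignedCycLFunction
    (h : pollack_exists_plusMinusPAdicLFunction (W := W) (f := f) (p := p)) (hp2 : p ≠ 2)
    (hf : IsNewformOf W f) (hgood : W.HasGoodReductionAtPrime p) (hap : W.frobeniusTrace p = 0)
    (ε : ℤˣ) {r : ℚ} (hr : r ≠ 0) :
    ∃! F : PowerSeries ℚ_[p], IsSignedCycLFunction f p ε r F := by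
  obtain ⟨L, -, hL⟩ := exists_isSignedPAdicLFunction h hp2 hf hgood hap ε
  exact ⟨_, IsSignedCycLFunction.C_inv_mul_of_isSignedPAdicLFunction hp2 hf hgood hap hL r,
    fun F hF ↦ hF.unique hr
      (IsSignedCycLFunction.C_inv_mul_of_isSignedPAdicLFunction hp2 hf hgood hap hL r)⟩

/-- **Integrality in a unit normalisation** (the shape of Thm. 3.17's "if (irr_ℚ) holds, `ω` is good,
and `γ ∈ T`, then `𝓛^∘_{ω,γ}(g) ∈ Λ_{𝒪_λ}`" in the `r`-currency): if the period ratio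
`r = Ω⁺_{ω,γ}/Ω⁺_f` is a `p`-ADIC UNIT, then BSTW's `𝓛^ε_{ω,γ}(g) = u · L_p^ε` with `u = r⁻¹ ∈ ℤ_p^×`,
in particular it lies in `Λ` and generates the same ideal as Kobayashi's `L_p^ε`. (That `r` IS a
`p`-adic unit for good `ω` and `γ` an `𝒪`-basis under (irr_ℚ) is BSTW Lemma 2.5(ii) with Remark 2.3
and the Manin-constant / isogeny comparison `realPeriodRat_eq_unit_mul_plusPeriod`; it is NOT typed
here, see the module docstring.) [cite: Kobayashi2003, Thm. 3.2 (p. 7)]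
[claim: BurungaleSkinnerTianWan2024, status: under-review] [cite: BurungaleSkinnerTianWan2024, Thm. 3.17 (label ERLBKI-ss, integrality clause) and Lemma 2.5(ii) (label GorPer)] -/
theorem IsSignedCycLFunction.exists_isUnit_eq_of_norm_eq_one (hp2 : p ≠ 2) (hf : IsNewformOf W f)
    (hgood : W.HasGoodReductionAtPrime p) (hap : W.frobeniusTrace p = 0) {ε : ℤˣ} {r : ℚ}
    {F : PowerSeries ℚ_[p]} {L : IwasawaAlgebra p} (hr : ‖(r : ℚ_[p])‖ = 1)
    (hF : IsSignedCycLFunction f p ε r F) (hL : IsSignedPAdicLFunction f p ε L) :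
    ∃ u : ℤ_[p], IsUnit u ∧ F = iwasawaToPowerSeries p (PowerSeries.C u * L) := by
  have hr0 : r ≠ 0 := by
    rintro rfl
    rw [Rat.cast_zero, norm_zero] at hr
    exact zero_ne_one hr
  have hr' : (r : ℚ_[p]) ≠ 0 := by exact_mod_cast hr0
  have h := hF.C_mul_eq_of_isSignedPAdicLFunction hp2 hf hgood hap hr0 hL
  have hnorm : ‖((r : ℚ_[p]))⁻¹‖ ≤ 1 := by rw [norm_inv, hr, inv_one]
  refine ⟨⟨_, hnorm⟩, ?_, ?_⟩
  · rw [PadicInt.isUnit_iff]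
    show ‖((r : ℚ_[p]))⁻¹‖ = 1
    rw [norm_inv, hr, inv_one]
  · have hC : iwasawaToPowerSeries p (PowerSeries.C (⟨_, hnorm⟩ : ℤ_[p])) =
        PowerSeries.C ((r : ℚ_[p])⁻¹) := by
      rw [iwasawaToPowerSeries, PowerSeries.map_C, PadicInt.algebraMap_apply]
    rw [map_mul, hC, ← h, ← mul_assoc, ← map_mul, inv_mul_cancel₀ hr', map_one, one_mul]

end Unique

end Literature.NumberTheory.EllipticCurves.BurungaleSkinnerTianWan2024

end
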